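import Summits.BirchSwinnertonDyer.Rank1Residual.GaloisImage.TorsionLevelDevissageHigher
import Summits.BirchSwinnertonDyer.Rank1Residual.GaloisImage.TorsionLevelTwoDevissage
import Summits.BirchSwinnertonDyer.Rank1Residual.GaloisImage.TorsionReductionOfLe
import HarnessLib

/-!
# Injectivity of evaluation on the Kolyvagin systems of `E[3^{k+1}]` on `𝓕_can` at EVERY depth,
# from the `m = 1` injectivity — the induction over the dévissage
# (cell `b2b-bsdres`, team n1011, row T-INJ-DEV-K; seat p11 GEN 6; lead R5-69 (b)/(c), R5-70;
# skeleton `cells/n1011/skel/T-INJ-DEV-FB.md`; r1 ROUTE-1 §35 (γ))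

HONEST FRAMING (cell `b2b-bsdres`, run/shared/lean/b2b/bsd-rank1-residual/, verbatim in every
file): the goal of the cell is to DELETE the COMBINATION-SHAPED residual classes of the
Birch–Swinnerton-Dyer formula for ALL analytic-rank `≤ 1` elliptic curves over `ℚ` — "full BSD
formula for every rank `≤ 1` curve in class `C`" assembled STRICTLY from published theorems — so
that the rank-`≤ 1` remainder becomes exactly the CONSTRUCTION-SHAPED classes, which are TYPED
(missing-input `Prop`s), NOT attempted. This is not "finishing BSD". Team n1011 (N10 / N11, the
additive block X4 ∧ `p = 3`): research route on the CONSTRUCTION-SHAPED class X4; TOOL theorems; no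
class theorem; nothing is booked; no label and no RESIDUAL-MAP mark is moved. Theorems only: no
definition, no named fact, no `sorry`.  What this buys: the INJECTIVITY half of clause (1) of the
S24-DEEP port ([S24] Thm. 4.4 (1) at every `m`) becomes a theorem at every depth GIVEN (H.2) at that
depth, canonical admissible data, and the `m = 1` injectivity (R1-56 (G) / R1-58) — debt reduction
inside the port, NOT coverage; existence / freeness at depth `≥ 2` and Thm. 4.4 (2) are untouched.

## What

* §1 `TorsionLevel.torsionGaloisModule_eq_one_of_dvd` — kernel containment `E[d] ⊆ E[N]`
  (`d ∣ N`), feeding `S24Deep.frobeniusClassPrimes_mono` (deep classes are sub-classes).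
* §2 **`TorsionLevel.apply_eq_zero_of_apply_eq_zero_succ`** — the STEP `m = k+1 ⟹ m = k+2`:
  n1011-p15's `KSDevissage.apply_eq_zero_of_apply_eq_zero_of_devissage` instantiated along
  `0 → E[3] → E[3^{k+1}·3] →(red) E[3^k·3] → 0` (`red` from n1011-p11's constructor
  `exists_torsionReduction_pow_mul`, internal to the proof), every hypothesis of F-A discharged by
  name: `hexact`/`hinji`/`hFπ`/`hFi`/local injectivity/bases from `TorsionLevelDevissageHigher`
  (K1), `hfsπ`/`hfsi` from n1011-p15's `CanonicalComparisonLevelChange` (F-B1b), transverse push/pull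
  from `TorsionLevelTwoDevissageLocal` (F-B2a), local shapes from `KolyvaginPrimeLocalShapeRat[Holds]`
  and `KolyvaginCoreVertices` (`unramified_inf_transverse_eq_bot`).  Binder list = n1011-p15's
  `apply_eq_zero_of_apply_eq_zero_levelTwo` one level up, plus the middle datum `D₃` on `E[3^k·3]`
  and `hinj₃` (injectivity there).
* §3 **`TorsionLevel.apply_eq_zero_of_apply_eq_zero_allDepths`** — induction on `k ≥ 1`: for a family
  of canonical admissible data `D j` on `E[3^j·3]` (all `j`) and `D₁` on `E[3]` with ONE prime set
  inside the class of level `3^{k+1}` and ONE `η`, injectivity at `n₀` on `KS(E[3], 𝓕̄_can, D₁)` gives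
  injectivity at `n₀` on `KS(E[3^k·3], 𝓕_can, D k)` for EVERY `k ≥ 1` (base `k = 1` = n1011-p15's
  `apply_eq_zero_of_apply_eq_zero_levelTwo`); subgroup form `injective_eval_kolyvaginSystems_allDepths`.

HYPOTHESES (nothing hidden): no `Γ_ℚ`-fixed point on any `E[3^j·3]` and on `E[3]` (from surj(3):
n1011-p11 `Transport.geomTorsion_eq_zero_of_fixed_of_surj`); (H.2)-shape cokernels for `τ` at every
level (tower rows; n1011-p15 `exists_tau_forall_levels_of_towerSurj`); canonical comparison maps with
one `η` and admissibility at every level (n1011-p04's constructor + n1011-p11 GEN 4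
`isAdmissible_of_hasCanonicalComparison_…`); the prime set inside the class of the deepest level and
outside `S`; `hinj₁`.  NOT used: [S24] facts, UPPER facts, GZK, parity.

References: B. Mazur, K. Rubin, Mem. AMS 799 (2004) Thm. 4.4.1, §4.5; R. Sakamoto, JTNB 36 (2024)
Thm. 4.4 (1) [Sakamoto2024]; K. Rubin, PCMI 18 (2011) Cor. 2.8.9 [Rubin2011].
-/

noncomputable section

open scoped Classical NumberField ContRepresentation
open Field NumberField IsDedekindDomain Module
open WeierstrassCurve Literature.NumberTheory.EllipticCurves Literature.NumberTheory.GaloisRepresentations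
  Literature.NumberTheory.GaloisRepresentations.DiscreteGaloisModule Literature.NumberTheory.GaloisCohomology
open Summit.BirchSwinnertonDyer.Rank1Residual.GaloisImage.KSDevissage

namespace Summit.BirchSwinnertonDyer.Rank1Residual.GaloisImage.TorsionLevel

variable (W : WeierstrassCurve ℚ) [W.IsElliptic]

/-! ### §1 Kernel containments `E[d] ⊆ E[N]` -/

omit [W.IsElliptic] in
/-- `Γ_ℚ` acts trivially on `E[d]` wherever it acts trivially on `E[N]`, `d ∣ N` (`E[d] ↪ E[N]`): the
kernel containment behind the inclusion of Frobenius classes `𝒫_N ⊆ 𝒫_d`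
(`S24Deep.frobeniusClassPrimes_mono`). [folklore] -/
theorem torsionGaloisModule_eq_one_of_dvd {d N : ℤ} (h : d ∣ N) (u : absoluteGaloisGroup ℚ)
    (hu : W.torsionGaloisModule N u = 1) : W.torsionGaloisModule d u = 1 := by
  apply LinearMap.ext
  intro P
  have hinj : Function.Injective (W.torsionInclusion h) :=
    fun P Q hPQ => Subtype.ext (congrArg Subtype.val hPQ :)
  apply hinj
  change W.torsionInclusion h ((W.torsionGaloisModule d).toContRepresentation u P) = W.torsionInclusion h P
  rw [ContIntertwiningMap.isIntertwining]
  change W.torsionGaloisModule N u (W.torsionInclusion h P) = _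
  rw [hu]
  rfl

/-! ### §2 The step `m = k + 1 ⟹ m = k + 2` -/

/-- **Injectivity dévissage one level up, for EVERY `k`** (n1011-p15's
`apply_eq_zero_of_apply_eq_zero_levelTwo` with `E[9]` replaced by `E[3^{k+1}·3]` and the middle term
`E[3^k·3]`).  Let `W/ℚ` be elliptic with no `Γ_ℚ`-fixed point on `E[3^k·3]`; `S` a finite set of
places outside which `𝓕_can` on `E[3^{k+1}·3]` and `𝓕̄_can` on `E[3]` are unramified;
`τ ∈ Gal(ℚ̄/ℚ(μ_{3^{k+2}}))` with cyclic cokernels `ℤ/3^{k+2}`, `ℤ/3^{k+1}`, `ℤ/3` on the three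
modules.  Let `D₂`, `D₃`, `D₁` be Kolyvagin data on `E[3^{k+1}·3]`, `E[3^k·3]`, `E[3]` with the SAME
primes, inside Sakamoto's class of `τ` at level `3^{k+2}` and outside `S`, cyclotomic transverse
conditions, THE canonical comparison maps for ONE `η`, `D₂` admissible.  If evaluation at `n₀` is
injective on `KS(E[3], 𝓕̄_can, D₁)` and on `KS(E[3^k·3], 𝓕_can, D₃)`, then every Kolyvagin system
`κ` of `(E[3^{k+1}·3], 𝓕_can, D₂)` with `κ_{n₀} = 0` vanishes.
[cite: Sakamoto2024, Def. 3.5 (p. 923) and Thm. 4.4 (1) (p. 926)] [cite: Rubin2011, Def. 2.2.1 (p. 18)] -/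
theorem apply_eq_zero_of_apply_eq_zero_succ [Finite (geomTorsion W ((3 : ℕ) : ℤ))] (k : ℕ)
    (h0 : ∀ P : geomTorsion W (((3 : ℕ) : ℤ) ^ k * ((3 : ℕ) : ℤ)),
      (∀ σ : absoluteGaloisGroup ℚ,
        W.torsionGaloisModule (((3 : ℕ) : ℤ) ^ k * ((3 : ℕ) : ℤ)) σ P = P) → P = 0)
    {S : Finset (Place ℚ)}
    (h𝓕₂ : (propagatedSelmerStructure W 3 (k + 1)).IsUnramifiedOutside S)
    (h𝓕₁ : (propagatedSelmerStructureOne W 3).IsUnramifiedOutside S)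
    {Sset : Set (HeightOneSpectrum (𝓞 ℚ))} {τ : absoluteGaloisGroup ℚ}
    (hτμ : τ ∈ rootsOfUnityFixer ℚ (3 ^ (k + 1 + 1)))
    (hτ₂ : Nonempty (cokerSubOne (W.torsionGaloisModule (((3 : ℕ) : ℤ) ^ (k + 1) * ((3 : ℕ) : ℤ))) τ ≃+
      ZMod (3 ^ (k + 1 + 1))))
    (hτ₃ : Nonempty (cokerSubOne (W.torsionGaloisModule (((3 : ℕ) : ℤ) ^ k * ((3 : ℕ) : ℤ))) τ ≃+
      ZMod (3 ^ (k + 1))))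
    (hτ₁ : Nonempty (cokerSubOne (W.torsionGaloisModule ((3 : ℕ) : ℤ)) τ ≃+ ZMod 3))
    {D₂ : KolyvaginDatum (W.torsionGaloisModule (((3 : ℕ) : ℤ) ^ (k + 1) * ((3 : ℕ) : ℤ)))}
    {D₃ : KolyvaginDatum (W.torsionGaloisModule (((3 : ℕ) : ℤ) ^ k * ((3 : ℕ) : ℤ)))}
    {D₁ : KolyvaginDatum (W.torsionGaloisModule ((3 : ℕ) : ℤ))}
    (hP₁ : D₁.primes = D₂.primes) (hP₃ : D₃.primes = D₂.primes)
    (hP₂ : D₂.primes ⊆ frobeniusClassPrimes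
      (W.torsionGaloisModule (((3 : ℕ) : ℤ) ^ (k + 1) * ((3 : ℕ) : ℤ))) Sset τ (3 ^ (k + 1 + 1)))
    (hPS : ∀ q ∈ D₂.primes, (Sum.inr q : Place ℚ) ∉ S)
    (hT₂ : D₂.transverse = cyclotomicTransverse _) (hT₃ : D₃.transverse = cyclotomicTransverse _)
    (hT₁ : D₁.transverse = cyclotomicTransverse _)
    {η : (q : HeightOneSpectrum (𝓞 ℚ)) → (ZMod (Ideal.absNorm q.asIdeal))ˣ}
    (hD₂ : D₂.HasCanonicalComparison (3 ^ (k + 1 + 1)) η) (hD₃ : D₃.HasCanonicalComparison (3 ^ (k + 1)) η)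
    (hD₁ : D₁.HasCanonicalComparison 3 η) (hadm₂ : D₂.IsAdmissible)
    {n₀ : Finset (HeightOneSpectrum (𝓞 ℚ))}
    (hinj₁ : ∀ lam : Finset (HeightOneSpectrum (𝓞 ℚ)) →
        galoisCohomology (W.torsionGaloisModule ((3 : ℕ) : ℤ)) 1,
      D₁.IsKolyvaginSystem (propagatedSelmerStructureOne W 3) lam → lam n₀ = 0 → ∀ n, lam n = 0)
    (hinj₃ : ∀ μ : Finset (HeightOneSpectrum (𝓞 ℚ)) →
        galoisCohomology (W.torsionGaloisModule (((3 : ℕ) : ℤ) ^ k * ((3 : ℕ) : ℤ))) 1,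
      D₃.IsKolyvaginSystem (propagatedSelmerStructure W 3 k) μ → μ n₀ = 0 → ∀ n, μ n = 0)
    {κ : Finset (HeightOneSpectrum (𝓞 ℚ)) →
      galoisCohomology (W.torsionGaloisModule (((3 : ℕ) : ℤ) ^ (k + 1) * ((3 : ℕ) : ℤ))) 1}
    (hκ : D₂.IsKolyvaginSystem (propagatedSelmerStructure W 3 (k + 1)) κ) (h0κ : κ n₀ = 0)
    (n : Finset (HeightOneSpectrum (𝓞 ℚ))) : κ n = 0 := by
  classical
  haveI : Fact (Nat.Prime 3) := ⟨Nat.prime_three⟩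
  haveI : Fact (1 < 3) := ⟨by norm_num⟩
  haveI : Fact (1 < 3 ^ (k + 1)) := ⟨Nat.one_lt_pow (Nat.succ_ne_zero _) (by norm_num)⟩
  haveI : NeZero (3 ^ (k + 1 + 1)) := ⟨pow_ne_zero _ (by norm_num)⟩
  haveI : NeZero (3 ^ (k + 1)) := ⟨pow_ne_zero _ (by norm_num)⟩
  haveI : Finite (geomTorsion W (((3 : ℕ) : ℤ) ^ (k + 1) * ((3 : ℕ) : ℤ))) :=
    finite_geomTorsion_pow_mul W 3 (k + 1)
  haveI : Finite (geomTorsion W (((3 : ℕ) : ℤ) ^ k * ((3 : ℕ) : ℤ))) := finite_geomTorsion_pow_mul W 3 k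
  -- the reduction `red : E[3^{k+1}·3] → E[3^k·3]`, `x ↦ 3x`
  obtain ⟨red, hred'⟩ := exists_torsionReduction_pow_mul W 3 k (k + 1)
  have hred : ∀ x : geomTorsion W (((3 : ℕ) : ℤ) ^ (k + 1) * ((3 : ℕ) : ℤ)),
      ((red x : geomTorsion W (((3 : ℕ) : ℤ) ^ k * ((3 : ℕ) : ℤ))) : geomPoints W) =
        ((3 : ℕ) : ℤ) • (x : geomPoints W) := fun x => by
    rw [hred', Nat.add_sub_cancel_left, pow_one]
  set incl := W.torsionInclusion (three_dvd_pow_succ_mul k) with hincl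
  -- divisibilities, sub-classes, roots of unity, exponents
  have hdvd₂₃ : 3 ^ (k + 1) ∣ 3 ^ (k + 1 + 1) := pow_dvd_pow 3 (Nat.le_succ _)
  have hdvd₂₁ : 3 ∣ 3 ^ (k + 1 + 1) := dvd_pow_self 3 (Nat.succ_ne_zero _)
  have hker₃ : ∀ u : absoluteGaloisGroup ℚ, (W.torsionGaloisModule (((3 : ℕ) : ℤ) ^ (k + 1) * ((3 : ℕ) : ℤ))) u = 1 → (W.torsionGaloisModule (((3 : ℕ) : ℤ) ^ k * ((3 : ℕ) : ℤ))) u = 1 := fun u hu =>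
    torsionGaloisModule_eq_one_of_dvd W (Transport.pow_mul_dvd_pow_mul (Nat.le_succ k)) u hu
  have hker₁ : ∀ u : absoluteGaloisGroup ℚ, (W.torsionGaloisModule (((3 : ℕ) : ℤ) ^ (k + 1) * ((3 : ℕ) : ℤ))) u = 1 → (W.torsionGaloisModule ((3 : ℕ) : ℤ)) u = 1 := fun u hu =>
    torsionGaloisModule_eq_one_of_dvd W (three_dvd_pow_succ_mul k) u hu
  have hmono₃ : ∀ q ∈ D₂.primes, q ∈ frobeniusClassPrimes (W.torsionGaloisModule (((3 : ℕ) : ℤ) ^ k * ((3 : ℕ) : ℤ))) Sset τ (3 ^ (k + 1)) := fun q hq =>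
    S24Deep.frobeniusClassPrimes_mono (W.torsionGaloisModule (((3 : ℕ) : ℤ) ^ k * ((3 : ℕ) : ℤ))) (W.torsionGaloisModule (((3 : ℕ) : ℤ) ^ (k + 1) * ((3 : ℕ) : ℤ))) hker₃ Sset τ hdvd₂₃ (hP₂ hq)
  have hmono₁ : ∀ q ∈ D₂.primes, q ∈ frobeniusClassPrimes (W.torsionGaloisModule ((3 : ℕ) : ℤ)) Sset τ 3 := fun q hq =>
    S24Deep.frobeniusClassPrimes_mono (W.torsionGaloisModule ((3 : ℕ) : ℤ)) (W.torsionGaloisModule (((3 : ℕ) : ℤ) ^ (k + 1) * ((3 : ℕ) : ℤ))) hker₁ Sset τ hdvd₂₁ (hP₂ hq)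
  have hτμ₁ : τ ∈ rootsOfUnityFixer ℚ 3 := rootsOfUnityFixer_le_of_dvd ℚ hdvd₂₁ hτμ
  have hM₂ : ∀ m : geomTorsion W (((3 : ℕ) : ℤ) ^ (k + 1) * ((3 : ℕ) : ℤ)), 3 ^ (k + 1 + 1) • m = 0 :=
    pow_succ_nsmul_geomTorsion_eq_zero W 3 (k + 1)
  have hM₁ : ∀ m : geomTorsion W ((3 : ℕ) : ℤ), 3 • m = 0 := three_nsmul_geomTorsion_three W
  -- per-prime instances and local shapes
  have hprime : ∀ q : HeightOneSpectrum (𝓞 ℚ), Fact (Ideal.absNorm q.asIdeal).Prime :=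
    fun q => ⟨FSComp.prime_absNorm_rat q⟩
  have hne : ∀ q : HeightOneSpectrum (𝓞 ℚ),
      NeZero ((Ideal.absNorm q.asIdeal : ℕ) : q.adicCompletion ℚ) := fun q => by
    haveI : CharZero (q.adicCompletion ℚ) :=
      charZero_of_injective_algebraMap (algebraMap ℚ (q.adicCompletion ℚ)).injective
    exact ⟨Nat.cast_ne_zero.2 (FSComp.prime_absNorm_rat q).ne_zero⟩
  have hsup₁ : ∀ q ∈ D₂.primes, unramifiedSubgroup (GaloisRep.toLocal q (W.torsionGaloisModule ((3 : ℕ) : ℤ))) 1 ⊔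
      cyclotomicTransverse (W.torsionGaloisModule ((3 : ℕ) : ℤ)) (Sum.inr q) = ⊤ := fun q hq => by
    haveI := hprime q; haveI := hne q
    exact unramifiedSubgroup_sup_cyclotomicTransverse_eq_top_of_mem_frobeniusClassPrimes (W.torsionGaloisModule ((3 : ℕ) : ℤ)) (hmono₁ q hq)
      (absNorm_sub_one_smul_eq_zero_of_mem_frobeniusClassPrimes (W.torsionGaloisModule ((3 : ℕ) : ℤ)) (hmono₁ q hq) hτμ₁ hM₁)
      (modPCyclotomicCharacter_surjOn_absInertia_rat_holds q)
  have hM₂' : ∀ q ∈ D₂.primes, ∀ m : geomTorsion W (((3 : ℕ) : ℤ) ^ (k + 1) * ((3 : ℕ) : ℤ)),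
      (Ideal.absNorm q.asIdeal - 1) • m = 0 := fun q hq =>
    absNorm_sub_one_smul_eq_zero_of_mem_frobeniusClassPrimes (W.torsionGaloisModule (((3 : ℕ) : ℤ) ^ (k + 1) * ((3 : ℕ) : ℤ))) (hP₂ hq) hτμ hM₂
  have hU₂ : ∀ q ∈ D₂.primes,
      Nat.card (unramifiedSubgroup (GaloisRep.toLocal q (W.torsionGaloisModule (((3 : ℕ) : ℤ) ^ (k + 1) * ((3 : ℕ) : ℤ)))) 1) = 3 ^ (k + 1 + 1) := fun q hq =>
    natCard_unramifiedSubgroup_toLocal_of_mem_frobeniusClassPrimes (W.torsionGaloisModule (((3 : ℕ) : ℤ) ^ (k + 1) * ((3 : ℕ) : ℤ))) (hP₂ hq) hτ₂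
  have hTc₂ : ∀ q ∈ D₂.primes, Nat.card (D₂.transverse (Sum.inr q)) = 3 ^ (k + 1 + 1) := fun q hq => by
    haveI := hprime q; haveI := hne q
    rw [hT₂]
    exact natCard_cyclotomicTransverse_rat_of_mem_frobeniusClassPrimes' (W.torsionGaloisModule (((3 : ℕ) : ℤ) ^ (k + 1) * ((3 : ℕ) : ℤ))) (hP₂ hq) hτ₂ (hM₂' q hq)
  have hUT₂ : ∀ q ∈ D₂.primes, unramifiedSubgroup (GaloisRep.toLocal q (W.torsionGaloisModule (((3 : ℕ) : ℤ) ^ (k + 1) * ((3 : ℕ) : ℤ)))) 1 ⊔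
      D₂.transverse (Sum.inr q) = ⊤ := fun q hq => by
    haveI := hprime q; haveI := hne q
    rw [hT₂]
    exact unramifiedSubgroup_sup_cyclotomicTransverse_eq_top_of_mem_frobeniusClassPrimes (W.torsionGaloisModule (((3 : ℕ) : ℤ) ^ (k + 1) * ((3 : ℕ) : ℤ))) (hP₂ hq)
      (hM₂' q hq) (modPCyclotomicCharacter_surjOn_absInertia_rat_holds q)
  have hinf₂ : ∀ q ∈ D₂.primes, unramifiedSubgroup (GaloisRep.toLocal q (W.torsionGaloisModule (((3 : ℕ) : ℤ) ^ (k + 1) * ((3 : ℕ) : ℤ)))) 1 ⊓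
      cyclotomicTransverse (W.torsionGaloisModule (((3 : ℕ) : ℤ) ^ (k + 1) * ((3 : ℕ) : ℤ))) (Sum.inr q) = ⊥ := fun q hq => by
    rw [← hT₂]
    exact CoreRankOne.unramified_inf_transverse_eq_bot hadm₂ hU₂ hTc₂ hUT₂ hq
  have hinjloc : ∀ q ∈ D₂.primes, Function.Injective (localMap incl (Sum.inr q)) := fun q hq =>
    localMap_torsionInclusion_injective W k red hred q
      (natCard_invariants_toLocal_of_mem_frobeniusClassPrimes (W.torsionGaloisModule (((3 : ℕ) : ℤ) ^ (k + 1) * ((3 : ℕ) : ℤ))) (hP₂ hq) hτ₂)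
      (natCard_invariants_toLocal_of_mem_frobeniusClassPrimes (W.torsionGaloisModule (((3 : ℕ) : ℤ) ^ k * ((3 : ℕ) : ℤ))) (hmono₃ q hq) hτ₃)
      (natCard_invariants_toLocal_of_mem_frobeniusClassPrimes (W.torsionGaloisModule ((3 : ℕ) : ℤ)) (hmono₁ q hq) hτ₁)
  -- matched bases for the two comparison compatibilities
  obtain ⟨n₂, b, b', hb⟩ := exists_bases_red W k red hred
  obtain ⟨n₁, c, c', hc⟩ := exists_bases_torsionMulBy W k
  refine apply_eq_zero_of_apply_eq_zero_of_devissage incl red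
    (exists_map_torsionInclusion_eq_of_map_red_eq_zero W k red hred)
    (map_torsionInclusion_injective W k red hred h0) hP₁ hP₃
    (fun q hq => (h𝓕₁.2 q (hPS q hq)).le) (fun q hq => (h𝓕₂.2 q (hPS q hq)).le)
    ?_ ?_ ?_ ?_ ?_ ?_ hinj₁ hinj₃ hκ h0κ n
  · -- `𝓕_can(E[3^{k+1}·3])` pushes forward into `𝓕_can(E[3^k·3])`
    intro v y hy
    exact localMap_red_mem_propagatedSelmerStructure W k red hred v hy
  · -- transverse push
    intro q hq y hy
    rw [hT₂] at hy
    rw [hT₃]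
    exact localMap_mem_cyclotomicTransverse red q hy
  · -- comparison transport (n1011-p15 F-B1b)
    intro q hq y hy w hw
    exact singularMap_localMap_eq_fs_of_hasCanonicalComparison hdvd₂₃ red b b' hb hD₂ hD₃ hq
      (hP₃.symm ▸ hq) (hP₂ hq).2.2.1 (hmono₃ q hq).2.2.1 hy w hw
  · -- `𝓕_can` is cartesian (n1011-p13)
    intro v x hx
    exact mem_propagatedSelmerStructureOne_of_localMap_torsionInclusion_mem W k v x hx
  · -- transverse pull-back
    intro q hq x hx
    rw [hT₂] at hx
    rw [hT₁]
    exact mem_cyclotomicTransverse_of_localMap_mem incl q (hsup₁ q hq) (hinf₂ q hq) (hinjloc q hq) hx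
  · -- comparison reflection (n1011-p15 F-B1b), through `[3^{k+1}] : E[3^{k+1}·3] ↠ E[3]`
    intro q hq y hy w hw
    exact singularMap_eq_fs_of_localMap_of_hasCanonicalComparison hdvd₂₁
      (W.torsionMulBy (((3 : ℕ) : ℤ) ^ (k + 1)) ((3 : ℕ) : ℤ)) c c' hc incl
      (isSES_torsionInclusion_red W k red hred).injective hD₂ hD₁ hq (hP₁.symm ▸ hq) (hP₂ hq).2.2.1
      (hmono₁ q hq).2.2.1 hy w hw

/-! ### §3 All depths, by induction from `m = 1` -/

/-- **Injectivity of evaluation on `KS(E[3^k·3], 𝓕_can)` at EVERY depth `k ≥ 1` from the `m = 1`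
injectivity** (the injectivity half of [S24] Thm. 4.4 (1) / [MR04] Thm. 4.4.1 at every `m ≥ 2`, by
induction on the length along `0 → E[3] → E[3^{k+1}·3] → E[3^k·3] → 0`).  Data: canonical admissible
Kolyvagin data `D j` on `E[3^j·3]` for every `j` and `D₁` on `E[3]`, all with ONE prime set `P` inside
Sakamoto's class of `τ` at level `3^{k+1}` and outside `S`, cyclotomic transverse conditions and ONE
`η`; (H.2)-shape cokernels for `τ` at every level; no `Γ_ℚ`-fixed points.  If evaluation at `n₀` is
injective on `KS(E[3], 𝓕̄_can, D₁)` (`hinj₁`: n1011-p11's G5 / base rigidity R1-58 at `n₀ = ∅`), then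
every Kolyvagin system of `(E[3^k·3], 𝓕_can, D k)` vanishing at `n₀` vanishes — for EVERY `k ≥ 1`.
Base `k = 1`: n1011-p15's `apply_eq_zero_of_apply_eq_zero_levelTwo`; step: `…_succ`.
[cite: Sakamoto2024, Thm. 4.4 (1) (p. 926)] [cite: Rubin2011, Cor. 2.8.9 (p. 25)] -/
theorem apply_eq_zero_of_apply_eq_zero_allDepths [Finite (geomTorsion W ((3 : ℕ) : ℤ))]
    (h0 : ∀ (j : ℕ) (P : geomTorsion W (((3 : ℕ) : ℤ) ^ j * ((3 : ℕ) : ℤ))),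
      (∀ σ : absoluteGaloisGroup ℚ,
        W.torsionGaloisModule (((3 : ℕ) : ℤ) ^ j * ((3 : ℕ) : ℤ)) σ P = P) → P = 0)
    (h0₁ : ∀ P : geomTorsion W ((3 : ℕ) : ℤ),
      (∀ σ : absoluteGaloisGroup ℚ, W.torsionGaloisModule ((3 : ℕ) : ℤ) σ P = P) → P = 0)
    {S : Finset (Place ℚ)}
    (h𝓕 : ∀ j : ℕ, (propagatedSelmerStructure W 3 j).IsUnramifiedOutside S)
    (h𝓕₁ : (propagatedSelmerStructureOne W 3).IsUnramifiedOutside S)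
    {Sset : Set (HeightOneSpectrum (𝓞 ℚ))} {τ : absoluteGaloisGroup ℚ}
    (hτ : ∀ j : ℕ, Nonempty (cokerSubOne (W.torsionGaloisModule (((3 : ℕ) : ℤ) ^ j * ((3 : ℕ) : ℤ))) τ ≃+
      ZMod (3 ^ (j + 1))))
    (hτ₁ : Nonempty (cokerSubOne (W.torsionGaloisModule ((3 : ℕ) : ℤ)) τ ≃+ ZMod 3))
    (D : (j : ℕ) → KolyvaginDatum (W.torsionGaloisModule (((3 : ℕ) : ℤ) ^ j * ((3 : ℕ) : ℤ))))
    (D₁ : KolyvaginDatum (W.torsionGaloisModule ((3 : ℕ) : ℤ)))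
    {P : Set (HeightOneSpectrum (𝓞 ℚ))} (hP : ∀ j, (D j).primes = P) (hP₁ : D₁.primes = P)
    (hPS : ∀ q ∈ P, (Sum.inr q : Place ℚ) ∉ S)
    (hT : ∀ j, (D j).transverse = cyclotomicTransverse _) (hT₁ : D₁.transverse = cyclotomicTransverse _)
    {η : (q : HeightOneSpectrum (𝓞 ℚ)) → (ZMod (Ideal.absNorm q.asIdeal))ˣ}
    (hD : ∀ j, (D j).HasCanonicalComparison (3 ^ (j + 1)) η) (hD₁ : D₁.HasCanonicalComparison 3 η)
    (hadm : ∀ j, (D j).IsAdmissible)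
    {n₀ : Finset (HeightOneSpectrum (𝓞 ℚ))}
    (hinj₁ : ∀ lam : Finset (HeightOneSpectrum (𝓞 ℚ)) →
        galoisCohomology (W.torsionGaloisModule ((3 : ℕ) : ℤ)) 1,
      D₁.IsKolyvaginSystem (propagatedSelmerStructureOne W 3) lam → lam n₀ = 0 → ∀ n, lam n = 0)
    (k : ℕ) (hk : 1 ≤ k) (hτμ : τ ∈ rootsOfUnityFixer ℚ (3 ^ (k + 1)))
    (hPc : P ⊆ frobeniusClassPrimes
      (W.torsionGaloisModule (((3 : ℕ) : ℤ) ^ k * ((3 : ℕ) : ℤ))) Sset τ (3 ^ (k + 1)))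
    {κ : Finset (HeightOneSpectrum (𝓞 ℚ)) →
      galoisCohomology (W.torsionGaloisModule (((3 : ℕ) : ℤ) ^ k * ((3 : ℕ) : ℤ))) 1}
    (hκ : (D k).IsKolyvaginSystem (propagatedSelmerStructure W 3 k) κ) (h0κ : κ n₀ = 0)
    (n : Finset (HeightOneSpectrum (𝓞 ℚ))) : κ n = 0 := by
  induction k, hk using Nat.le_induction generalizing n with
  | base =>
    exact apply_eq_zero_of_apply_eq_zero_levelTwo W h0₁ (h𝓕 1) h𝓕₁ hτμ (hτ 1) hτ₁
      (hP₁.trans (hP 1).symm) (by rw [hP 1]; exact hPc) (fun q hq => hPS q ((hP 1) ▸ hq)) (hT 1) hT₁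
      (hD 1) hD₁ (hadm 1) hinj₁ hκ h0κ n
  | succ k hk ih =>
    have hdvd : 3 ^ (k + 1) ∣ 3 ^ (k + 1 + 1) := pow_dvd_pow 3 (Nat.le_succ _)
    have hker : ∀ u : absoluteGaloisGroup ℚ,
        W.torsionGaloisModule (((3 : ℕ) : ℤ) ^ (k + 1) * ((3 : ℕ) : ℤ)) u = 1 →
          W.torsionGaloisModule (((3 : ℕ) : ℤ) ^ k * ((3 : ℕ) : ℤ)) u = 1 := fun u hu =>
      torsionGaloisModule_eq_one_of_dvd W (Transport.pow_mul_dvd_pow_mul (Nat.le_succ k)) u hu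
    have hPc' : P ⊆ frobeniusClassPrimes (W.torsionGaloisModule (((3 : ℕ) : ℤ) ^ k * ((3 : ℕ) : ℤ)))
        Sset τ (3 ^ (k + 1)) := fun q hq =>
      S24Deep.frobeniusClassPrimes_mono _ _ hker Sset τ hdvd (hPc hq)
    have hτμ' : τ ∈ rootsOfUnityFixer ℚ (3 ^ (k + 1)) := rootsOfUnityFixer_le_of_dvd ℚ hdvd hτμ
    exact apply_eq_zero_of_apply_eq_zero_succ W k (h0 k) (h𝓕 (k + 1)) h𝓕₁
      hτμ (hτ (k + 1)) (hτ k) hτ₁ (hP₁.trans (hP _).symm) ((hP k).trans (hP _).symm)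
      (by rw [hP (k + 1)]; exact hPc) (fun q hq => hPS q ((hP (k + 1)) ▸ hq)) (hT _) (hT _) hT₁
      (hD (k + 1)) (hD k) hD₁ (hadm (k + 1)) hinj₁
      (fun μ hμ hμ0 m => ih hτμ' hPc' hμ hμ0 m) hκ h0κ n

/-- **Evaluation at `n₀` is injective on `KS(E[3^k·3], 𝓕_can, D k)` for every `k ≥ 1`** (subgroup
form of `apply_eq_zero_of_apply_eq_zero_allDepths`). [cite: Sakamoto2024, Thm. 4.4 (1) (p. 926)]
[cite: Rubin2011, Cor. 2.8.9 (p. 25)] -/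
theorem injective_eval_kolyvaginSystems_allDepths [Finite (geomTorsion W ((3 : ℕ) : ℤ))]
    (h0 : ∀ (j : ℕ) (P : geomTorsion W (((3 : ℕ) : ℤ) ^ j * ((3 : ℕ) : ℤ))),
      (∀ σ : absoluteGaloisGroup ℚ,
        W.torsionGaloisModule (((3 : ℕ) : ℤ) ^ j * ((3 : ℕ) : ℤ)) σ P = P) → P = 0)
    (h0₁ : ∀ P : geomTorsion W ((3 : ℕ) : ℤ),
      (∀ σ : absoluteGaloisGroup ℚ, W.torsionGaloisModule ((3 : ℕ) : ℤ) σ P = P) → P = 0)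
    {S : Finset (Place ℚ)}
    (h𝓕 : ∀ j : ℕ, (propagatedSelmerStructure W 3 j).IsUnramifiedOutside S)
    (h𝓕₁ : (propagatedSelmerStructureOne W 3).IsUnramifiedOutside S)
    {Sset : Set (HeightOneSpectrum (𝓞 ℚ))} {τ : absoluteGaloisGroup ℚ}
    (hτ : ∀ j : ℕ, Nonempty (cokerSubOne (W.torsionGaloisModule (((3 : ℕ) : ℤ) ^ j * ((3 : ℕ) : ℤ))) τ ≃+
      ZMod (3 ^ (j + 1))))
    (hτ₁ : Nonempty (cokerSubOne (W.torsionGaloisModule ((3 : ℕ) : ℤ)) τ ≃+ ZMod 3))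
    (D : (j : ℕ) → KolyvaginDatum (W.torsionGaloisModule (((3 : ℕ) : ℤ) ^ j * ((3 : ℕ) : ℤ))))
    (D₁ : KolyvaginDatum (W.torsionGaloisModule ((3 : ℕ) : ℤ)))
    {P : Set (HeightOneSpectrum (𝓞 ℚ))} (hP : ∀ j, (D j).primes = P) (hP₁ : D₁.primes = P)
    (hPS : ∀ q ∈ P, (Sum.inr q : Place ℚ) ∉ S)
    (hT : ∀ j, (D j).transverse = cyclotomicTransverse _) (hT₁ : D₁.transverse = cyclotomicTransverse _)
    {η : (q : HeightOneSpectrum (𝓞 ℚ)) → (ZMod (Ideal.absNorm q.asIdeal))ˣ}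
    (hD : ∀ j, (D j).HasCanonicalComparison (3 ^ (j + 1)) η) (hD₁ : D₁.HasCanonicalComparison 3 η)
    (hadm : ∀ j, (D j).IsAdmissible)
    {n₀ : Finset (HeightOneSpectrum (𝓞 ℚ))}
    (hinj₁ : ∀ lam : Finset (HeightOneSpectrum (𝓞 ℚ)) →
        galoisCohomology (W.torsionGaloisModule ((3 : ℕ) : ℤ)) 1,
      D₁.IsKolyvaginSystem (propagatedSelmerStructureOne W 3) lam → lam n₀ = 0 → ∀ n, lam n = 0)
    (k : ℕ) (hk : 1 ≤ k) (hτμ : τ ∈ rootsOfUnityFixer ℚ (3 ^ (k + 1)))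
    (hPc : P ⊆ frobeniusClassPrimes
      (W.torsionGaloisModule (((3 : ℕ) : ℤ) ^ k * ((3 : ℕ) : ℤ))) Sset τ (3 ^ (k + 1))) :
    Function.Injective fun κ : (D k).kolyvaginSystems (propagatedSelmerStructure W 3 k) => κ.1 n₀ := by
  intro κ κ' hκκ'
  have hmem : κ.1 - κ'.1 ∈ (D k).kolyvaginSystems (propagatedSelmerStructure W 3 k) := sub_mem κ.2 κ'.2
  have hd0 : (κ.1 - κ'.1) n₀ = 0 := by
    change κ.1 n₀ - κ'.1 n₀ = 0
    exact sub_eq_zero.mpr hκκ'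
  have hall := apply_eq_zero_of_apply_eq_zero_allDepths W h0 h0₁ h𝓕 h𝓕₁ hτ hτ₁ D D₁ hP hP₁ hPS hT hT₁
    hD hD₁ hadm hinj₁ k hk hτμ hPc ((KolyvaginDatum.mem_kolyvaginSystems_iff _ _ _).mp hmem) hd0
  apply Subtype.ext
  funext m
  exact sub_eq_zero.mp (hall m)

end Summit.BirchSwinnertonDyer.Rank1Residual.GaloisImage.TorsionLevel

end
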